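import Summits.Langlands.Langlands.Statement
import Literature.NumberTheory.Automorphic.FontaineMazurGL2WeightOne
import Literature.NumberTheory.GaloisRepresentations.EvenGaloisRep
import HarnessLib
/-!
# `ArtinWeightFMAllParitiesQ2` — F4 ON-PATH LEMMA (generation 17 on `ReciprocityUpToIrreducibility`, item stmt-Langlands-14328)

`theorem ArtinWeightFMAllParitiesQ2_of_Langlands : Langlands → ArtinWeightFMAllParitiesQ2` (and
`artinWeightFM_of_langlands θ : Langlands → ArtinWeightFM θ` for every `θ`): clause (B) of the summit for `n = 2`,
`K = ℚ` applies to every `ρ` of the sector (irreducible by hypothesis; geometric because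
`ReciprocityData.pst p v hv = fontainePstAdicCompletion v p hv` by `rfl` and `IsDeRhamWeightZeroGL2` gives de Rham-ness
at `v ∣ p`); `Corresponds` contains `SatakeFrobCompatibleAE` as its first conjunct.  No `sorry`.
-/
noncomputable section

set_option linter.dupNamespace false

open scoped MatrixGroups Matrix NumberField Classical
open NumberField IsDedekindDomain Field Filter
open Literature.NumberTheory.Automorphic Literature.NumberTheory.GaloisRepresentations
open Literature.NumberTheory.PAdicHodge
open Summit.Langlands

namespace Summit.Langlands.Langlands.Cruxes.ReciprocityUpToIrreducibility.ArtinWeightFMAllParitiesQ2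

/-! ## The family, its cells and the rung -/

/-- **The rung family** `E(θ)` — PARITY `θ` of the Artin-weight (Hodge–Tate `(0,0)`) Fontaine–Mazur
statement for `GL₂` over `ℚ` in the INFINITE-IMAGE sector: for every odd prime `p` and every continuous,
a.e. unramified, irreducible `ρ : Γ_ℚ → GL₂(ℚ̄_p)` with `ρ̄|Γ_{ℚ(ζ_p)}` absolutely irreducible (TW),
residually generic at `p` (GEN), de Rham at `p` of labelled Hodge–Tate weights `{0,0}` (equivalently
potentially unramified at `p`, Sen) and with INFINITE image, subject to the parity clause
`θ = 0 → ρ` odd, `θ = 1 → ρ` even (`θ ≥ 2`: no parity clause), there is an `L`-algebraic cuspidal `π`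
of `GL₂(𝔸_ℚ)` attached to `ρ` at almost all places.  `θ = 0`: Pan 2022 Thm. 1.0.5 (FLOOR cell, in the
tree); `θ = 1`: the EVEN cell (open: the even case of the unramified Fontaine–Mazur conjecture,
Fontaine–Mazur Conj. 5a, at Taylor–Wiles level); `θ = 2`: THE RUNG (no parity clause = both cells).
[cite: Pan2022LocallyAnalytic, Thm. 1.0.5] [cite: AllenCalegari2014, Thm. 1, Cor. 2, Cor. 3]
[cite: FontaineMazur1995, Conj. 5a] -/
def ArtinWeightFM (θ : ℕ) : Prop :=
  ∀ (p : ℕ) [Fact p.Prime], p ≠ 2 →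
    ∀ (ρ : FramedGaloisRep ℚ (PadicAlgCl p) 2),
      (∀ᶠ v : HeightOneSpectrum (𝓞 ℚ) in cofinite, ρ.IsUnramifiedAt v) →
      ρ.toGaloisRep.IsIrreducible →
      (θ = 0 → ρ.IsOdd) →
      (θ = 1 → ρ.IsEven) →
      (ρ.restrictField (CyclotomicField p ℚ)).IsResiduallyAbsIrreducible →
      (∀ v : HeightOneSpectrum (𝓞 ℚ), ((p : ℕ) : 𝓞 ℚ) ∈ v.asIdeal → IsResiduallyGenericGL2At ρ v) →
      IsDeRhamWeightZeroGL2 p ρ →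
      (Set.range ⇑ρ).Infinite →
      ∀ (hcpt : isCompact_glFiniteIntegralLevel 2 ℚ) (ι : PadicAlgCl p ≃+* ℂ),
        ∃ π : CuspidalAutomorphicRepData 2 ℚ hcpt, π.1.IsLAlgebraic ∧ SatakeFrobCompatibleAE ι π.1 ρ

/-- The ODD cell `E(0)` (the floor instance of the family: Pan 2022 Thm. 1.0.5 restricted to infinite image). -/
def OddArtinWeightInfiniteImageQ2 : Prop := ArtinWeightFM 0

/-- The EVEN cell `E(1)` — the open core of the rung: every irreducible, a.e. unramified, EVEN
`ρ : Γ_ℚ → GL₂(ℚ̄_p)` (`p` odd) that is de Rham of Hodge–Tate weights `(0,0)` at `p`, has infinite image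
and satisfies (TW) and (GEN) is automorphic (conjecturally this sector is EMPTY: Fontaine–Mazur 5a). -/
def EvenArtinWeightInfiniteImageQ2 : Prop := ArtinWeightFM 1

/-- **THE RUNG** (the filed statement): the family at `θ = 2` — the Artin-weight Fontaine–Mazur
statement for `GL₂/ℚ` in the infinite-image sector with NO PARITY HYPOTHESIS (Pan's theorem with "odd"
deleted). -/
def ArtinWeightFMAllParitiesQ2 : Prop := ArtinWeightFM 2

/-! ## F4 — on-path: the summit implies every cell and the rung -/

/-- **ON-PATH**: `Langlands → E(θ)` for EVERY `θ`: clause (B) of the summit for `n = 2`, `K = ℚ` and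
any reciprocity datum (one exists by the `Nonempty` conjunct) applies to every `ρ` of the sector — it is
irreducible by hypothesis and geometric because `ReciprocityData.pst p v hv = fontainePstAdicCompletion v p hv`
by `rfl` and `IsDeRhamWeightZeroGL2` supplies de Rham-ness at `v ∣ p`; `Corresponds` contains
`SatakeFrobCompatibleAE` as its first conjunct.  Parity, weights, image and residual clauses unused. -/
theorem artinWeightFM_of_langlands (θ : ℕ) (hL : _root_.Langlands) : ArtinWeightFM θ := by
  intro p _ _hp ρ hunr hirr _hodd _heven _htw _hgen hdr _hinf hcpt ι
  obtain ⟨⟨Rec⟩, hall⟩ := hL ℚ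
  have hB : GaloisToAutomorphic 2 Rec hcpt := (hall Rec 2 two_pos hcpt).2
  have hdR : ∀ (v : HeightOneSpectrum (𝓞 ℚ)) (hv : ((p : ℕ) : 𝓞 ℚ) ∈ v.asIdeal),
      (Rec.pst p v hv).IsDeRhamFramed (ρ.toLocal v) := by
    intro v hv
    change (fontainePstAdicCompletion v p hv).IsDeRhamFramed (ρ.toLocal v)
    exact (hdr v hv).1
  have hgeo : IsGeometricFramed Rec ρ := ⟨hunr, hdR⟩
  obtain ⟨π, hπL, hcorr⟩ := hB p ι ρ hirr hgeo
  refine ⟨π, hπL, ?_⟩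
  filter_upwards [hcorr.1] with v hv
  exact hv

/-- **F4 on-path lemma for the rung**: `Langlands → ArtinWeightFMAllParitiesQ2`. -/
@[aesop safe apply]
theorem ArtinWeightFMAllParitiesQ2_of_Langlands (hL : _root_.Langlands) : ArtinWeightFMAllParitiesQ2 :=
  artinWeightFM_of_langlands 2 hL

/-- On-path for the even cell. -/
theorem EvenArtinWeightInfiniteImageQ2_of_Langlands (hL : _root_.Langlands) :
    EvenArtinWeightInfiniteImageQ2 :=
  artinWeightFM_of_langlands 1 hL

example : _root_.Langlands → ArtinWeightFMAllParitiesQ2 := by intro h; aesop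

end Summit.Langlands.Langlands.Cruxes.ReciprocityUpToIrreducibility.ArtinWeightFMAllParitiesQ2

end
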